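import Literature.NumberTheory.PAdicHodge.AinfWeierstrassTateModule
import Literature.NumberTheory.PAdicHodge.AinfWeierstrassEtaPeriodAdd
import Literature.NumberTheory.PAdicHodge.AinfWeierstrassEtaPeriodTheta
import HarnessLib

/-!
# The η-period as a bundled `Γ_F`-equivariant homomorphism `T_pŴ(𝒪_{ℂ_F}) →+ B_dR⁺(F)`

Topic `Literature/NumberTheory/PAdicHodge`; the fourth period map of the programme of `AinfWeierstrassTateModule` (which bundles
`[·]`, `∫ω` and `HT` on `TatePt F p W = T_pŴ(𝒪_{ℂ_F})`), built from the Banach-free η-period of `AinfWeierstrassEtaPeriod`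
(`∫_t η = η₀([t]) − ι(Σ_{i≥1} p^{i−1} R_p(Tᵢ))`), its additivity `etaPeriod_addSeq` (`AinfWeierstrassEtaPeriodAdd`) and its
`θ`-value / transversality (`AinfWeierstrassEtaPeriodTheta`):

* **`etaPeriodHom W hθ : TatePt F p W →+ BdRPlusTop F p`, `τ ↦ ∫_τ η`** (additive by `etaPeriod_addSeq`), hence `ℤ`-linear
  (`etaPeriodHom_zsmul`);
* **`gal_etaPeriodHom : σ(∫_τ η) = ∫_{στ} η`** (`gal_etaPeriod`);
* `thetaBdR_etaPeriodHom : θ_dR(∫_τ η) = −θ(corr τ)` and the transversality criterion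
  **`etaPeriodHom_not_mem_filOne : R_p(τ₁) ∉ p𝒪_{ℂ_F} ⇒ ∫_τ η ∉ Fil¹ B_dR⁺`**, to be contrasted with `omegaPeriodHom_mem_filOne`.

So `τ ↦ (∫_τ ω, ∫_τ η)` is a pair of additive `Γ_F`-equivariant maps `T_pŴ(𝒪_{ℂ_F}) → B_dR⁺(F)`, the first with values in
`Fil¹`, the second leaving `Fil¹` as soon as `R_p(τ₁)` is a non-multiple of `p` (Colmez 1992 §2: the two de Rham periods of
the `p`-divisible group of `Ŵ`). What is NOT here: `ℤ_[p]`-linearity (continuity in `τ`), and the valuation computation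
`v(R_p(τ₁)) = p/(p²−1)` at supersingular reduction which discharges the hypothesis of the criterion. BSD context: crux K★
`stmt-BirchSwinnertonDyer-22226`, hDR sector (iii) road (A); BSD is not proved by any of this.

## References
* P. Colmez, *Périodes p-adiques des variétés abéliennes*, Math. Ann. 292 (1992), §2. [Colmez1992PeriodesAbeliennes]
* J.-M. Fontaine, *Le corps des périodes p-adiques*, Astérisque 223 (1994), Exp. II §1.5. [FontaineAsterisque223III]
* J. Tate, *p-divisible groups* (1967), §4. [Tate1967]
-/

noncomputable section

open Ideal Filter Topology Field WittVector MvPowerSeries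

namespace Literature.NumberTheory.PAdicHodge

open Literature.NumberTheory.GaloisRepresentations
open Literature.NumberTheory.GaloisRepresentations.IsNonarchimedeanLocalField
open Literature.NumberTheory.GaloisRepresentations.LubinTate
open Literature.NumberTheory.EllipticCurves

namespace AinfTop

variable {F : Type} [Field F] [ValuativeRel F] [TopologicalSpace F] [IsNonarchimedeanLocalField F]
  {p : ℕ} [Fact p.Prime] [Fact (¬ IsUnit (p : integerC F))]
  [IsAdicComplete (Ideal.span {(p : integerC F)}) (integerC F)] [CharZero F]
  {hθ : Function.Surjective (fontaineTheta (integerC F) p)}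
  (W : WeierstrassCurve ℤ)

/-- Congruence for `etaPeriod` in the sequence. [cite: Colmez1992PeriodesAbeliennes, §2] -/
theorem etaPeriod_congr_seq {t t' : ℕ → (maxNilIdealC F).toIdeal} (h : t = t')
    (ht0 : (t 0 : CBall F) = 0) (htp : ∀ n, mulPC F p W (t (n + 1)) = t n)
    (ht0' : (t' 0 : CBall F) = 0) (htp' : ∀ n, mulPC F p W (t' (n + 1)) = t' n) :
    etaPeriod W hθ t ht0 htp = etaPeriod W hθ t' ht0' htp' := by subst h; rfl

/-- Congruence for `etaCorr` in the sequence. [cite: Colmez1992PeriodesAbeliennes, §2] -/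
theorem etaCorr_congr_seq {t t' : ℕ → (maxNilIdealC F).toIdeal} (h : t = t')
    (htp : ∀ n, mulPC F p W (t (n + 1)) = t n) (htp' : ∀ n, mulPC F p W (t' (n + 1)) = t' n) :
    etaCorr W hθ t htp = etaCorr W hθ t' htp' := by subst h; rfl

/-- **The η-period as a homomorphism `T_pŴ(𝒪_{ℂ_F}) →+ B_dR⁺(F)`, `τ ↦ ∫_τ η`** (additive by `etaPeriod_addSeq`).
[cite: Colmez1992PeriodesAbeliennes, §2] -/
def etaPeriodHom (hθ : Function.Surjective (fontaineTheta (integerC F) p)) : TatePt F p W →+ BdRPlusTop F p :=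
  AddMonoidHom.mk' (fun τ => etaPeriod W hθ (seq W τ) (seq_zero W τ) (mulPC_seq W τ)) fun τ τ' =>
    (etaPeriod_congr_seq W (seq_add W τ τ') _ _ (coe_addSeq_zero W (seq_zero W τ) (seq_zero W τ'))
      (mulPC_addSeq W (mulPC_seq W τ) (mulPC_seq W τ'))).trans
      (etaPeriod_addSeq W (hθ := hθ) (seq_zero W τ) (seq_zero W τ') (mulPC_seq W τ) (mulPC_seq W τ'))

/-- Unfolding `etaPeriodHom`. [cite: Colmez1992PeriodesAbeliennes, §2] -/
theorem etaPeriodHom_apply (τ : TatePt F p W) :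
    etaPeriodHom W hθ τ = etaPeriod W hθ (seq W τ) (seq_zero W τ) (mulPC_seq W τ) := rfl

/-- `∫_t η` of an unbundled sequence is `etaPeriodHom` of the bundled one. [cite: Colmez1992PeriodesAbeliennes, §2] -/
theorem etaPeriodHom_ofSeq (t : ℕ → (maxNilIdealC F).toIdeal) (ht0 : (t 0 : CBall F) = 0)
    (htp : ∀ n, mulPC F p W (t (n + 1)) = t n) : etaPeriodHom W hθ (ofSeq W t ht0 htp) = etaPeriod W hθ t ht0 htp := rfl

/-- **`Γ_F`-equivariance of the η-period: `σ(∫_τ η) = ∫_{σ τ} η`.** [cite: Colmez1992PeriodesAbeliennes, §2]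
[cite: FontaineAsterisque223III, Exp. II §1.5.4] -/
theorem gal_etaPeriodHom (σ : absoluteGaloisGroup F) (τ : TatePt F p W) :
    BdRPlusTop.gal F p σ (etaPeriodHom W hθ τ) = etaPeriodHom W hθ (σ • τ) := by
  rw [etaPeriodHom_apply, etaPeriodHom_apply, gal_etaPeriod W σ (seq_zero W τ) (mulPC_seq W τ)]
  exact etaPeriod_congr_seq W (seq_smul W σ τ).symm _ _ _ _

/-- **The η-period is `ℤ`-linear**: `∫_{n τ} η = n ∫_τ η`. [cite: Colmez1992PeriodesAbeliennes, §2] -/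
theorem etaPeriodHom_zsmul (n : ℤ) (τ : TatePt F p W) : etaPeriodHom W hθ (n • τ) = n • etaPeriodHom W hθ τ :=
  map_zsmul _ n τ

/-- `∫_0 η = 0`. [cite: Colmez1992PeriodesAbeliennes, §2] -/
theorem etaPeriodHom_zero : etaPeriodHom W hθ (0 : TatePt F p W) = 0 := map_zero _

/-- **`θ_dR(∫_τ η) = −θ(corr τ)`** (`= −Σ_{i≥0} pⁱ R_p(τ_{i+1})`, `tendsto_thetaCorrPartial`). [cite: Colmez1992PeriodesAbeliennes, §2] -/
theorem thetaBdR_etaPeriodHom (τ : TatePt F p W) :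
    thetaBdR ((BdRPlusTop.of F p).symm (etaPeriodHom W hθ τ)) =
      -((theta F p (etaCorr W hθ (seq W τ) (mulPC_seq W τ)) : CBall F) : CompletedAlgClosure F) :=
  thetaBdR_etaPeriod W (seq_zero W τ) (mulPC_seq W τ)

/-- **Transversality: `R_p(τ₁) ∉ p𝒪_{ℂ_F} ⇒ θ_dR(∫_τ η) ≠ 0`.** [cite: Colmez1992PeriodesAbeliennes, §2] -/
theorem thetaBdR_etaPeriodHom_ne_zero (τ : TatePt F p W) (h₁ : mulDefectC W p (seq W τ 1) ∉ Ideal.span {(p : CBall F)}) :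
    thetaBdR ((BdRPlusTop.of F p).symm (etaPeriodHom W hθ τ)) ≠ 0 :=
  thetaBdR_etaPeriod_ne_zero W (seq_zero W τ) (mulPC_seq W τ) h₁

/-- **`R_p(τ₁) ∉ p𝒪_{ℂ_F} ⇒ ∫_τ η ∉ Fil¹ B_dR⁺`** (contrast `omegaPeriodHom_mem_filOne : ∫_τ ω ∈ Fil¹`).
[cite: Colmez1992PeriodesAbeliennes, §2] -/
theorem etaPeriodHom_not_mem_filOne (τ : TatePt F p W) (h₁ : mulDefectC W p (seq W τ 1) ∉ Ideal.span {(p : CBall F)}) :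
    etaPeriodHom W hθ τ ∉ (BdRPlusTop.filOne F p).toIdeal :=
  etaPeriod_not_mem_filOne W (seq_zero W τ) (mulPC_seq W τ) h₁

/-- **Independence of the two periods at a transverse point**: if `R_p(τ₁) ∉ p𝒪_{ℂ_F}` then no `b ∈ B_dR⁺` satisfies
`∫_τ η = b · ∫_τ ω` (the right side lies in the ideal `Fil¹`, the left side does not). [cite: Colmez1992PeriodesAbeliennes, §2] -/
theorem etaPeriodHom_ne_mul_omegaPeriodHom (τ : TatePt F p W) (h₁ : mulDefectC W p (seq W τ 1) ∉ Ideal.span {(p : CBall F)})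
    (b : BdRPlusTop F p) : etaPeriodHom W hθ τ ≠ b * omegaPeriodHom W hθ τ := fun h =>
  etaPeriodHom_not_mem_filOne W τ h₁ (h ▸ Ideal.mul_mem_left _ b (omegaPeriodHom_mem_filOne W τ))

end AinfTop

end Literature.NumberTheory.PAdicHodge

end
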